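import Summits.QuantumFields.BalabanUV.Beta.FP.BiVertexLimit
import Summits.QuantumFields.BalabanUV.Beta.FP.MixVertexLimit
import Summits.QuantumFields.BalabanUV.Beta.FP.ResponseVertexLimit
import Summits.QuantumFields.BalabanUV.Beta.FP.RoadEndLeftUndressed
import Summits.QuantumFields.BalabanUV.Beta.FP.PerfectAveragingTables

/-!
# `BalabanUV.Beta.FP.PerfectTableFixedPoint` — road «FP» for binder row D1, owner row **N1-J∞-W** (d1-p3 g12 ROWS OPEN, `LEAVES-FP.md`), FILE 2∕2:
# THE SECOND-ORDER FIXED-POINT EQUATION OF THE LITERAL — `W∞ = Π̂ (W2SymOfK Ginf Lc S♭∞ M∞ S₂∞ M₂∞) Π̂ᵀ` for the END's `W∞ = WPerfOf … Wt 1` — from the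
# continuity of an2's carrier `W2SymOfK` along rate families (§1, generic glue) and the displayed (CONV-C)-type rows of the five unit-rescaled slots
# (`JETS-JM-DESIGN.md` v2 §4 (d); the table slots discharged by FILE 1 `PerfectAveragingTables` under (M-H)(ShH)(Shmix))

HONEST DEPENDENCY (page 1, mandatory): continuum YM on T⁴ ⇐ BetaPertH ∧ nine spine estimates (0/9 proved); BetaPertH ⇐ (D1) ∧ (D4) ∧ CAP+tail;
G-an2-4 gates asym, D1 and NE2/3/4.  HONEST FRAMING (cell contract, verbatim): «discharging `BetaPertH` makes Bałaban's UV stability UNCONDITIONAL —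
a real constructive-QFT result; it is NOT the continuum limit and NOT the Clay problem.»  THIS MODULE is [folklore] kernel bookkeeping (entrywise limits of
absolutely convergent lattice sums; no `def`, no `def … : Prop`, nothing cited, 0 sorry).  Every rate ∕ row below is a HYPOTHESIS SHAPE with free constants,
asserted for no object of Bałaban's.  0∕4 row-D1 binders; discharges NO (CONV-C) row and NO table letter; NOT N2, NOT SDF, NOT D1, NOT BetaPertH, NOT continuum,
NOT Clay.  «not in print; our bookkeeping».

ABSOLUTE RULE (cell charter, verbatim): «No internally-minted statement may enter as a cited fact. Every hypothesis is either kernel-proved in this package or a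
verbatim quotation of a PUBLISHED theorem with page reference. The manuscript(s) under audit are NOT citable for their own disputed steps — they are the thing
under adjudication; programme-internal (2001/route/tribunal) claims are never citable.»

WHY (owner d1-p3 g12, `JETS-JM-DESIGN.md` v2 §4 (d), row N1-J∞-W): the literal's second-order slot at step `j` is `W2SymOfK (Gsym j) Lc (SpureSymOf j) (tabs.M j)
(T2RecOf … j) (M2Of 3 Lc tabs.mixFF j)` (an2's `WsymOf_eq` ∕ `WrecOf_eq`), and in leg units it is the SAME carrier over the unit-rescaled slots (an4's
`SecondOrderUnits.unitW_W2SymOfK`).  Jet stationarity under R-FP-41 is therefore the FIXED-POINT EQUATION obtained by passing `j → ∞` INSIDE the carrier — legitimate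
exactly when the carrier is continuous along the family.  an1∕an2's carrier is `W2SymOfK = ½•(W2OfK + swap)`, `W2OfK = vertex2OfK + mixOfK + mixOfK(swapped) +
dM ∘ K2OfK` (`SecondOrderResponse.W2OfK_apply`); the owner's three limit modules give the summand-wise continuity (`BiVertexLimit.tendsto_vertex2OfK`,
`MixVertexLimit.tendsto_mixOfK`∕`_swap`, `ResponseVertexLimit.tendsto_resp`); this file ADDS THEM UP.

CONTENT ([folklore]; generic `d`, `N`; one rate `m > 0` and one ratio `0 ≤ θ < 1` for all five slots — a slot with a smaller ratio or zero rate constant is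
covered by monotonicity of the hypothesis shapes).
* §1 `tendsto_W2OfK`, **`tendsto_W2SymOfK`** (entrywise convergence of the carrier along the family) and **`limTabOf_W2SymOfK_eq`**:
  K-slot `Decays (K j) C m`, `Decays Kinf C m`, `Decays (K j − Kinf) (cK·θ^j) m`; S-slot `LocStencil` (`Cs`, `cS`); M-slot `VertexFamily _ N` (`CM`, `cM`); S₂-slot
  `LocStencil₂` (`C₂`, `c₂`); M₂-slot `LocStencilFM N` (`CM₂`, `cM₂`) ⟹ `limTabOf (fun j => W2SymOfK (K j) N (S j) (M j) (S₂ j) (M₂ j)) = W2SymOfK Kinf N Sinf Minf S₂inf M₂inf`.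
* §2 THE LITERAL, UNDRESSED (d = 3): `JsB12Sym0_W_eq_W2SymOfK` (the step-`j` table of `JsB12Sym0` IS the carrier over its five slots `(Gsym j, SpureSymOf j, tabs.M j,
  T2RecOf … j, M2Of 3 Lc tabs.mixFF j)` — `rfl`-level), `unitW_JsB12Sym0_W_eq` (its unit form, `SecondOrderUnits.unitW_W2SymOfK`), and
  **`limTabOf_unitW_JsB12Sym0_eq`**: under the DISPLAYED rows of the five unit-rescaled slots — (G) `unitK_j (Gsym Lc j) → Ginf` (RESIDUAL #16 KPERF-SYM; leaf-06
  displays the same), (S♭) `unitS_j (SpureSymOf … j) → S♭∞` (the PURE part, NOT the END's `hS0∕hSall0`), (M), (S₂) `unitS₂_j (T2RecOf … j) → S₂∞` (NEW displayed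
  row), (M₂) — `limTabOf (fun j => unitW (sfStep Lc j) (smStep 3 Lc j) (JsB12Sym0 … j).W) = W2SymOfK Ginf Lc S♭∞ M∞ S₂∞ M₂∞`.
* §3 DRESSED = THE END's OBJECT: **`wPerfOf_JsB12Sym_eq_dress`** — with `hWt1 : ∀ j, Wt j 1 = (JsB12Sym …).W` and the END's own `hW0 hWall0 hδW hθW0 hθW1` VERBATIM
  (`RoadLeftLiteralWard.d1Drift_JsB12Sym_of_sliceLedger_straight_wardTables`), plus the slot rows of §2,
  `WPerfOf (sfStep Lc) (smStep 3 Lc) Wt 1 = fun μ y ν y' => dressKSymAt (toSite (ctrOff 4 Lc)) Lc (W2SymOfK Ginf Lc S♭∞ M∞ S₂∞ M₂∞ μ y ν y')`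
  (`RoadEndLeftUndressed.unitW_JsB12Sym_eq_dress`, `SymJetDressingUnits.limTabOf_dressSym_eq`, `HessKerDressedLimit.vertexFamily₂_(sub_)limTabOf`, §2).
* §4 THE TABLE SLOTS DISCHARGED: **`wPerfOf_JsB12Sym_eq_dress_of_ff`** — §3 with (M)(M₂) replaced by the new root's pin (M-H) `hM1 : ∀ j ρ w, tabs.M j ρ w = M1Of 3 Lc tabs.H cΛ j ρ w`
  (an2 P2 p268146) + the block-shape letters (ShH) `∀ μ w, ffK (tabs.H μ w) = tabs.H μ w`, (Shmix) `∀ κ u ρ w, ffK (tabs.mixFF κ u ρ w) = tabs.mixFF κ u ρ w` + ONE letter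
  `LocStencilFM Lc tabs.mixFF CM₂ m` at the common rate (`tabs.hH` supplies the `H` letter at every rate itself): `M∞ = fun μ w => cΛ • tabs.H μ w`, `M₂∞ = tabs.mixFF`
  (FILE 1 `PerfectAveragingTables`).
NOT HERE (part 3 of the row): the m-fold (m ≥ 2) DEFINITION `Wt∞ m := W2SymOfK (KPerf m) (Lc^m) S∞ M^{(m)}∞ S₂∞ M₂^{(m)}∞` (R-FP-41′ at the limit) and the S₂-slot's own
limit equation through `e4OfKW` (`T2RecOf_succ`); the (G)∕(S♭)∕(S₂) rows stay HYPOTHESES.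
Provenance: D1 formalisation swarm LEAF PROVER 02, unit b2b-balaban-beta-d1-formalise-leaf-02 gen 12, 2026-08-21 (MINE journal «N1-J∞-W», INTENT 2).  Over the
owner's `BiVertexLimit` ∕ `MixVertexLimit` ∕ `ResponseVertexLimit` ∕ `SymJetDressingUnits` (d1-p3 g10), leaf-06's `RoadEndLeftUndressed`, an2's `SymmetrisedStepJets` ∕
`RecursiveWSlot`, an4's `SecondOrderUnits` BY NAME; no existing file touched.
-/

noncomputable section

namespace Summit.QuantumFields.BalabanUV.Beta.FP.PerfectTableFixedPoint

open Filter Topology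
open Literature.MathematicalPhysics.QuantumFieldTheory.Balaban1983to89
open Literature.MathematicalPhysics.QuantumFieldTheory.Balaban1983to89.Beta
open ExpKernelCalculus (MKer Decays BiLoc VertexFamily)
open OneStepResolventKernel (Fib LocStencil)
open BalabanCompositeJets (LocStencil₂)
open SecondOrderResponse (vertex2OfK mixOfK dM K2OfK W2OfK W2OfK_apply W2SymOfK LocStencilFM)
open HessKerDressedLimit (limMKerOf limTabOf limTabOf_apply limMKerOf_eq_of_tendsto)
open Summit.QuantumFields.BalabanUV.Beta.FP.BiVertexLimit (tendsto_vertex2OfK)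
open Summit.QuantumFields.BalabanUV.Beta.FP.MixVertexLimit (tendsto_mixOfK tendsto_mixOfK_swap)
open Summit.QuantumFields.BalabanUV.Beta.FP.ResponseVertexLimit (tendsto_resp)

/-! ## §1 The carrier `W2SymOfK` is continuous along rate families: the constructed limit is the carrier of the limits -/

section Glue

variable {d : ℕ} {N : ℕ} [NeZero N] {K : ℕ → MKer (d + 1) (Fib d)} {Kinf : MKer (d + 1) (Fib d)}
  {S : ℕ → Fin (d + 1) → (Fin (d + 1) → ℤ) → MKer (d + 1) (Fib d)} {Sinf : Fin (d + 1) → (Fin (d + 1) → ℤ) → MKer (d + 1) (Fib d)}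
  {M : ℕ → Fin (d + 1) → (Fin (d + 1) → ℤ) → MKer (d + 1) (Fib d)} {Minf : Fin (d + 1) → (Fin (d + 1) → ℤ) → MKer (d + 1) (Fib d)}
  {S₂ : ℕ → Fin (d + 1) → (Fin (d + 1) → ℤ) → Fin (d + 1) → (Fin (d + 1) → ℤ) → MKer (d + 1) (Fib d)}
  {S₂inf : Fin (d + 1) → (Fin (d + 1) → ℤ) → Fin (d + 1) → (Fin (d + 1) → ℤ) → MKer (d + 1) (Fib d)}
  {M₂ : ℕ → Fin (d + 1) → (Fin (d + 1) → ℤ) → Fin (d + 1) → (Fin (d + 1) → ℤ) → MKer (d + 1) (Fib d)}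
  {M₂inf : Fin (d + 1) → (Fin (d + 1) → ℤ) → Fin (d + 1) → (Fin (d + 1) → ℤ) → MKer (d + 1) (Fib d)}
  {C cK Cs cS CM cM C₂ c₂ CM₂ cM₂ m θ : ℝ}

/-- [folklore] **THE SECOND-ORDER CARRIER `W2OfK` CONVERGES ENTRYWISE ALONG A RATE FAMILY**: with uniform rows and geometric rates (ratio `θ ∈ [0,1)`, rate `m > 0`) of
the five slots `(K_j, S_j, M_j, S₂,j, M₂,j) → (K∞, S∞, M∞, S₂∞, M₂∞)` — `Decays` ∕ `LocStencil` ∕ `VertexFamily _ N` ∕ `LocStencil₂` ∕ `LocStencilFM N` — every entry of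
`W2OfK (K j) N (S j) (M j) (S₂ j) (M₂ j) μ y ν y′` tends to the corresponding entry of `W2OfK K∞ N S∞ M∞ S₂∞ M₂∞ μ y ν y′`.  Proof: `W2OfK_apply` + the four summand
limits `tendsto_vertex2OfK`, `tendsto_mixOfK`, `tendsto_mixOfK_swap`, `tendsto_resp`. -/
theorem tendsto_W2OfK (hK : ∀ j, Decays (K j) C m) (hKinf : Decays Kinf C m) (hKrate : ∀ j, Decays (K j - Kinf) (cK * θ ^ j) m)
    (hS : ∀ j, LocStencil (S j) Cs m) (hSinf : LocStencil Sinf Cs m) (hSrate : ∀ j, LocStencil (S j - Sinf) (cS * θ ^ j) m)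
    (hM : ∀ j, VertexFamily (M j) N CM m) (hMinf : VertexFamily Minf N CM m) (hMrate : ∀ j, VertexFamily (M j - Minf) N (cM * θ ^ j) m)
    (hS₂ : ∀ j, LocStencil₂ (S₂ j) C₂ m) (hS₂inf : LocStencil₂ S₂inf C₂ m) (hS₂rate : ∀ j, LocStencil₂ (S₂ j - S₂inf) (c₂ * θ ^ j) m)
    (hM₂ : ∀ j, LocStencilFM N (M₂ j) CM₂ m) (hM₂inf : LocStencilFM N M₂inf CM₂ m) (hM₂rate : ∀ j, LocStencilFM N (M₂ j - M₂inf) (cM₂ * θ ^ j) m)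
    (hm : 0 < m) (hθ0 : 0 ≤ θ) (hθ1 : θ < 1) (μ : Fin (d + 1)) (y : Fin (d + 1) → ℤ) (ν : Fin (d + 1)) (y' : Fin (d + 1) → ℤ)
    (x z : Fin (d + 1) → ℤ) (a b : Fib d) :
    Tendsto (fun j => W2OfK (K j) N (S j) (M j) (S₂ j) (M₂ j) μ y ν y' x z a b) atTop (𝓝 (W2OfK Kinf N Sinf Minf S₂inf M₂inf μ y ν y' x z a b)) := by
  have h1 := tendsto_vertex2OfK (N := N) hK hKinf hKrate hS₂ hS₂inf hS₂rate hm hθ0 hθ1 μ y ν y' x z a b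
  have h2 := tendsto_mixOfK (N := N) hK hKinf hKrate hM₂ hM₂inf hM₂rate hm hθ0 hθ1 μ y ν y' x z a b
  have h3 := tendsto_mixOfK_swap (N := N) hK hKinf hKrate hM₂ hM₂inf hM₂rate hm hθ0 hθ1 μ y ν y' x z a b
  have h4 := tendsto_resp (N := N) hK hKinf hKrate hS hSinf hSrate hM hMinf hMrate hm hθ0 hθ1 μ y ν y' x z a b
  simp only [W2OfK_apply, Pi.add_apply]
  exact ((h1.add h2).add h3).add h4

/-- [folklore] **THE SYMMETRISED CARRIER `W2SymOfK` CONVERGES ENTRYWISE ALONG A RATE FAMILY** (`W2SymOfK = ½•(W2OfK + swap)`; `tendsto_W2OfK` at both bond orders). -/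
theorem tendsto_W2SymOfK (hK : ∀ j, Decays (K j) C m) (hKinf : Decays Kinf C m) (hKrate : ∀ j, Decays (K j - Kinf) (cK * θ ^ j) m)
    (hS : ∀ j, LocStencil (S j) Cs m) (hSinf : LocStencil Sinf Cs m) (hSrate : ∀ j, LocStencil (S j - Sinf) (cS * θ ^ j) m)
    (hM : ∀ j, VertexFamily (M j) N CM m) (hMinf : VertexFamily Minf N CM m) (hMrate : ∀ j, VertexFamily (M j - Minf) N (cM * θ ^ j) m)
    (hS₂ : ∀ j, LocStencil₂ (S₂ j) C₂ m) (hS₂inf : LocStencil₂ S₂inf C₂ m) (hS₂rate : ∀ j, LocStencil₂ (S₂ j - S₂inf) (c₂ * θ ^ j) m)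
    (hM₂ : ∀ j, LocStencilFM N (M₂ j) CM₂ m) (hM₂inf : LocStencilFM N M₂inf CM₂ m) (hM₂rate : ∀ j, LocStencilFM N (M₂ j - M₂inf) (cM₂ * θ ^ j) m)
    (hm : 0 < m) (hθ0 : 0 ≤ θ) (hθ1 : θ < 1) (μ : Fin (d + 1)) (y : Fin (d + 1) → ℤ) (ν : Fin (d + 1)) (y' : Fin (d + 1) → ℤ)
    (x z : Fin (d + 1) → ℤ) (a b : Fib d) :
    Tendsto (fun j => W2SymOfK (K j) N (S j) (M j) (S₂ j) (M₂ j) μ y ν y' x z a b) atTop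
      (𝓝 (W2SymOfK Kinf N Sinf Minf S₂inf M₂inf μ y ν y' x z a b)) := by
  have h1 := tendsto_W2OfK (N := N) hK hKinf hKrate hS hSinf hSrate hM hMinf hMrate hS₂ hS₂inf hS₂rate hM₂ hM₂inf hM₂rate hm hθ0 hθ1
    μ y ν y' x z a b
  have h2 := tendsto_W2OfK (N := N) hK hKinf hKrate hS hSinf hSrate hM hMinf hMrate hS₂ hS₂inf hS₂rate hM₂ hM₂inf hM₂rate hm hθ0 hθ1
    ν y' μ y x z a b
  unfold W2SymOfK
  simp only [Pi.smul_apply, Pi.add_apply, smul_eq_mul]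
  exact (h1.add h2).const_mul (1 / 2 : ℝ)

/-- [folklore] **THE CONSTRUCTED LIMIT OF THE SECOND-ORDER CARRIER IS THE CARRIER OF THE LIMITS**: under the five slot rows of `tendsto_W2SymOfK`,
`limTabOf (fun j => W2SymOfK (K j) N (S j) (M j) (S₂ j) (M₂ j)) = W2SymOfK K∞ N S∞ M∞ S₂∞ M₂∞` — the shape of the second-order FIXED-POINT EQUATION of row N1-J∞-W
once `W j := unitW_j (WsymOf j)` is rewritten by `SecondOrderUnits.unitW_W2SymOfK` (the left side is then `WPerfOf`-type data, the right side the carrier at the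
limits of the unit-rescaled slots). -/
theorem limTabOf_W2SymOfK_eq (hK : ∀ j, Decays (K j) C m) (hKinf : Decays Kinf C m) (hKrate : ∀ j, Decays (K j - Kinf) (cK * θ ^ j) m)
    (hS : ∀ j, LocStencil (S j) Cs m) (hSinf : LocStencil Sinf Cs m) (hSrate : ∀ j, LocStencil (S j - Sinf) (cS * θ ^ j) m)
    (hM : ∀ j, VertexFamily (M j) N CM m) (hMinf : VertexFamily Minf N CM m) (hMrate : ∀ j, VertexFamily (M j - Minf) N (cM * θ ^ j) m)
    (hS₂ : ∀ j, LocStencil₂ (S₂ j) C₂ m) (hS₂inf : LocStencil₂ S₂inf C₂ m) (hS₂rate : ∀ j, LocStencil₂ (S₂ j - S₂inf) (c₂ * θ ^ j) m)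
    (hM₂ : ∀ j, LocStencilFM N (M₂ j) CM₂ m) (hM₂inf : LocStencilFM N M₂inf CM₂ m) (hM₂rate : ∀ j, LocStencilFM N (M₂ j - M₂inf) (cM₂ * θ ^ j) m)
    (hm : 0 < m) (hθ0 : 0 ≤ θ) (hθ1 : θ < 1) :
    limTabOf (fun j => W2SymOfK (K j) N (S j) (M j) (S₂ j) (M₂ j)) = W2SymOfK Kinf N Sinf Minf S₂inf M₂inf :=
  funext fun μ => funext fun y => funext fun ν => funext fun y' => by
    rw [limTabOf_apply]
    exact limMKerOf_eq_of_tendsto fun x z a b =>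
      tendsto_W2SymOfK (N := N) hK hKinf hKrate hS hSinf hSrate hM hMinf hMrate hS₂ hS₂inf hS₂rate hM₂ hM₂inf hM₂rate hm hθ0 hθ1 μ y ν y' x z a b

end Glue

/-! ## §2 The literal, undressed: the step-`j` table IS the carrier over its five slots; THE FIXED-POINT EQUATION under the displayed slot rows -/

section Literal

open ExpKernelCalculus (VertexFamily₂)
open AffineAveraging (toSite)
open AveragingContoursRooted (ctrOff ctrOff_mem_box)
open BalabanStepW2 (M2Of)
open WilsonVertex2Sym (wsym22)
open HessKerDressedLimit (vertexFamily₂_limTabOf vertexFamily₂_sub_limTabOf)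
open Summit.QuantumFields.BalabanUV.Beta.HessKerDressedUnits (unitK unitS unitW)
open Summit.QuantumFields.BalabanUV.Beta.SecondOrderUnits (unitM unitS₂ unitM₂ unitW_W2SymOfK)
open Summit.QuantumFields.BalabanUV.Beta.AxialDressingRooted (one_le_of_neZero)
open Summit.QuantumFields.BalabanUV.Beta.SymmetrisedDressingKernel (dressKSymAt)
open Summit.QuantumFields.BalabanUV.Beta.SymmetrisedStepJets (SymTables Gsym SpureSymOf WsymOf_eq JsSym0Of_W JsB12Sym0 JsB12Sym0_eq JsB12Sym)
open Summit.QuantumFields.BalabanUV.Beta.SpineRooted (T2RecOf WrecOf_eq M1Of)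
open Summit.QuantumFields.BalabanUV.Beta.WardLocusStencils (ffK)
open Summit.QuantumFields.BalabanUV.Beta.GAN24.CombesThomas (sfStep smStep sfStep_ne_zero smStep_ne_zero)
open Summit.QuantumFields.BalabanUV.Beta.FP.PerfectObjectsT (WPerfOf)
open Summit.QuantumFields.BalabanUV.Beta.FP.SymJetDressingUnits (limTabOf_dressSym_eq)
open Summit.QuantumFields.BalabanUV.Beta.FP.RoadEndLeftUndressed (unitW_JsB12Sym_eq_dress)
open Summit.QuantumFields.BalabanUV.Beta.FP.PerfectAveragingTables (vertexFamily_unitM_M1Of_of_ff vertexFamily_Minf_of_loc vertexFamily_unitM_M1Of_sub_of_ff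
  locStencilFM_unitM₂_M2Of_of_ff locStencilFM_unitM₂_M2Of_sub_of_ff)

variable {Lc : ℕ} [NeZero Lc] (hLc : Odd Lc) (N : ℕ) (tabs : SymTables 3 Lc) (cΛ cB : ℝ)

/-- [folklore] **THE STEP-`j` SECOND-ORDER TABLE OF THE UNDRESSED LITERAL IS an2's CARRIER OVER ITS FIVE SLOTS** (`JsB12Sym0_eq`, `JsSym0Of_W`, `WsymOf_eq`, `WrecOf_eq` —
all `rfl`): resolvent `Gsym Lc j`, pure first-order table `SpureSymOf … j`, multiplier table `tabs.M j`, second field table `T2RecOf … j`, mixed table `M2Of 3 Lc tabs.mixFF j`,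
at the pins `(cE, cVH, cE₂, T) = (Lc⁴, −Lc⁸∕2, Lc⁸, (8N²)⁻¹•wsym22 N)`. -/
theorem JsB12Sym0_W_eq_W2SymOfK (j : ℕ) :
    (JsB12Sym0 hLc N tabs cΛ cB j).W =
      W2SymOfK (Gsym Lc j) Lc (SpureSymOf tabs ((Lc : ℝ) ^ 4) (-((Lc : ℝ) ^ 8 / 2)) cΛ j) (tabs.M j)
        (T2RecOf 3 Lc (Gsym Lc) (SpureSymOf tabs ((Lc : ℝ) ^ 4) (-((Lc : ℝ) ^ 8 / 2)) cΛ) tabs.M ((Lc : ℝ) ^ 8) cB ((8 * (N : ℝ) ^ 2)⁻¹ • wsym22 N)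
          tabs.vh₂S tabs.mixFF j)
        (M2Of 3 Lc tabs.mixFF j) := by
  rw [JsB12Sym0_eq, JsSym0Of_W, WsymOf_eq, WrecOf_eq]
  rfl

/-- [folklore] **… IN LEG UNITS**: `unitW_j (JsB12Sym0 … j).W = W2SymOfK (unitK_j (Gsym j)) Lc (unitS_j (SpureSymOf j)) (unitM_j (tabs.M j)) (unitS₂_j (T2RecOf … j)) (unitM₂_j (M2Of … j))`
(`SecondOrderUnits.unitW_W2SymOfK`; units `(sfStep Lc j, smStep 3 Lc j)`). -/
theorem unitW_JsB12Sym0_W_eq (j : ℕ) :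
    unitW (sfStep Lc j) (smStep 3 Lc j) (JsB12Sym0 hLc N tabs cΛ cB j).W =
      W2SymOfK (unitK (sfStep Lc j) (smStep 3 Lc j) (Gsym (d := 3) Lc j)) Lc
        (unitS (sfStep Lc j) (smStep 3 Lc j) (SpureSymOf tabs ((Lc : ℝ) ^ 4) (-((Lc : ℝ) ^ 8 / 2)) cΛ j))
        (unitM (sfStep Lc j) (smStep 3 Lc j) (tabs.M j))
        (unitS₂ (sfStep Lc j) (smStep 3 Lc j) (T2RecOf 3 Lc (Gsym Lc) (SpureSymOf tabs ((Lc : ℝ) ^ 4) (-((Lc : ℝ) ^ 8 / 2)) cΛ) tabs.M ((Lc : ℝ) ^ 8) cB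
          ((8 * (N : ℝ) ^ 2)⁻¹ • wsym22 N) tabs.vh₂S tabs.mixFF j))
        (unitM₂ (sfStep Lc j) (smStep 3 Lc j) (M2Of 3 Lc tabs.mixFF j)) := by
  rw [JsB12Sym0_W_eq_W2SymOfK]
  exact unitW_W2SymOfK (sfStep_ne_zero j) (smStep_ne_zero j) _ _ _ _ _

variable {Ginf : MKer 4 (Fib 3)} {Sinf Minf : Fin 4 → (Fin 4 → ℤ) → MKer 4 (Fib 3)}
  {S₂inf M₂inf : Fin 4 → (Fin 4 → ℤ) → Fin 4 → (Fin 4 → ℤ) → MKer 4 (Fib 3)} {C cK Cs cS CM cM C₂ c₂ CM₂ cM₂ m θ : ℝ}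

/-- [our object — bookkeeping] **THE SECOND-ORDER FIXED-POINT EQUATION AT THE UNDRESSED LITERAL.**  HYPOTHESES = the (CONV-C)-type rows of the five unit-rescaled slots,
all DISPLAYED (none is proved anywhere): (G) the symmetrised co-dressed resolvents `unitK_j (Gsym Lc j) → Ginf` in `Decays` (RESIDUAL #16 KPERF-SYM); (S♭) the PURE first-order
tables `unitS_j (SpureSymOf … j) → S♭∞` in `LocStencil` (NOT the END's `hS0∕hSall0`, which are about the full `SsymOf`; they differ by the Λ-term); (M) `unitM_j (tabs.M j) → M∞` in
`VertexFamily _ Lc`; (S₂) the second field tables `unitS₂_j (T2RecOf … j) → S₂∞` in `LocStencil₂`; (M₂) `unitM₂_j (M2Of 3 Lc tabs.mixFF j) → M₂∞` in `LocStencilFM Lc`; one rate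
`m > 0`, one ratio `θ ∈ [0,1)`.  CONCLUSION: `limTabOf (fun j => unitW_j (JsB12Sym0 … j).W) = W2SymOfK Ginf Lc S♭∞ M∞ S₂∞ M₂∞` — the limit of the literal's unit-rescaled
second-order tables IS the carrier at the slot limits (`unitW_JsB12Sym0_W_eq` + §1).  Discharges nothing. -/
theorem limTabOf_unitW_JsB12Sym0_eq
    (hK : ∀ j, Decays (unitK (sfStep Lc j) (smStep 3 Lc j) (Gsym (d := 3) Lc j)) C m) (hKinf : Decays Ginf C m)
    (hKrate : ∀ j, Decays (unitK (sfStep Lc j) (smStep 3 Lc j) (Gsym (d := 3) Lc j) - Ginf) (cK * θ ^ j) m)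
    (hS : ∀ j, LocStencil (unitS (sfStep Lc j) (smStep 3 Lc j) (SpureSymOf tabs ((Lc : ℝ) ^ 4) (-((Lc : ℝ) ^ 8 / 2)) cΛ j)) Cs m) (hSinf : LocStencil Sinf Cs m)
    (hSrate : ∀ j, LocStencil (unitS (sfStep Lc j) (smStep 3 Lc j) (SpureSymOf tabs ((Lc : ℝ) ^ 4) (-((Lc : ℝ) ^ 8 / 2)) cΛ j) - Sinf) (cS * θ ^ j) m)
    (hM : ∀ j, VertexFamily (unitM (sfStep Lc j) (smStep 3 Lc j) (tabs.M j)) Lc CM m) (hMinf : VertexFamily Minf Lc CM m)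
    (hMrate : ∀ j, VertexFamily (unitM (sfStep Lc j) (smStep 3 Lc j) (tabs.M j) - Minf) Lc (cM * θ ^ j) m)
    (hS₂ : ∀ j, LocStencil₂ (unitS₂ (sfStep Lc j) (smStep 3 Lc j) (T2RecOf 3 Lc (Gsym Lc) (SpureSymOf tabs ((Lc : ℝ) ^ 4) (-((Lc : ℝ) ^ 8 / 2)) cΛ) tabs.M
      ((Lc : ℝ) ^ 8) cB ((8 * (N : ℝ) ^ 2)⁻¹ • wsym22 N) tabs.vh₂S tabs.mixFF j)) C₂ m) (hS₂inf : LocStencil₂ S₂inf C₂ m)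
    (hS₂rate : ∀ j, LocStencil₂ (unitS₂ (sfStep Lc j) (smStep 3 Lc j) (T2RecOf 3 Lc (Gsym Lc) (SpureSymOf tabs ((Lc : ℝ) ^ 4) (-((Lc : ℝ) ^ 8 / 2)) cΛ) tabs.M
      ((Lc : ℝ) ^ 8) cB ((8 * (N : ℝ) ^ 2)⁻¹ • wsym22 N) tabs.vh₂S tabs.mixFF j) - S₂inf) (c₂ * θ ^ j) m)
    (hM₂ : ∀ j, LocStencilFM Lc (unitM₂ (sfStep Lc j) (smStep 3 Lc j) (M2Of 3 Lc tabs.mixFF j)) CM₂ m) (hM₂inf : LocStencilFM Lc M₂inf CM₂ m)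
    (hM₂rate : ∀ j, LocStencilFM Lc (unitM₂ (sfStep Lc j) (smStep 3 Lc j) (M2Of 3 Lc tabs.mixFF j) - M₂inf) (cM₂ * θ ^ j) m)
    (hm : 0 < m) (hθ0 : 0 ≤ θ) (hθ1 : θ < 1) :
    limTabOf (fun j => unitW (sfStep Lc j) (smStep 3 Lc j) (JsB12Sym0 hLc N tabs cΛ cB j).W) = W2SymOfK Ginf Lc Sinf Minf S₂inf M₂inf := by
  have e : (fun j => unitW (sfStep Lc j) (smStep 3 Lc j) (JsB12Sym0 hLc N tabs cΛ cB j).W) = fun j =>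
      W2SymOfK (unitK (sfStep Lc j) (smStep 3 Lc j) (Gsym (d := 3) Lc j)) Lc
        (unitS (sfStep Lc j) (smStep 3 Lc j) (SpureSymOf tabs ((Lc : ℝ) ^ 4) (-((Lc : ℝ) ^ 8 / 2)) cΛ j))
        (unitM (sfStep Lc j) (smStep 3 Lc j) (tabs.M j))
        (unitS₂ (sfStep Lc j) (smStep 3 Lc j) (T2RecOf 3 Lc (Gsym Lc) (SpureSymOf tabs ((Lc : ℝ) ^ 4) (-((Lc : ℝ) ^ 8 / 2)) cΛ) tabs.M ((Lc : ℝ) ^ 8) cB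
          ((8 * (N : ℝ) ^ 2)⁻¹ • wsym22 N) tabs.vh₂S tabs.mixFF j))
        (unitM₂ (sfStep Lc j) (smStep 3 Lc j) (M2Of 3 Lc tabs.mixFF j)) :=
    funext fun j => unitW_JsB12Sym0_W_eq hLc N tabs cΛ cB j
  rw [e]
  exact limTabOf_W2SymOfK_eq (N := Lc) hK hKinf hKrate hS hSinf hSrate hM hMinf hMrate hS₂ hS₂inf hS₂rate hM₂ hM₂inf hM₂rate hm hθ0 hθ1

/-! ## §3 Dressed: the END's second-order family of record `WPerfOf (sfStep Lc) (smStep 3 Lc) Wt 1` -/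

/-- [our object — bookkeeping] **THE SECOND-ORDER FIXED-POINT EQUATION FOR THE END's OBJECT.**  With the END's pin `hWt1 : ∀ j, Wt j 1 = (JsB12Sym …).W` and its W-rows
`hW0 hWall0 hδW hθW0 hθW1` VERBATIM (`RoadLeftLiteralWard.d1Drift_JsB12Sym_of_sliceLedger_straight_wardTables`), plus the five slot rows of `limTabOf_unitW_JsB12Sym0_eq`:
`WPerfOf (sfStep Lc) (smStep 3 Lc) Wt 1 = fun μ y ν y' => dressKSymAt ρ_c Lc (W2SymOfK Ginf Lc S♭∞ M∞ S₂∞ M₂∞ μ y ν y')` — the perfect second-order table of the road is the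
(0.4)-dressing of an2's carrier at the slot limits.  Route: `WPerfOf` unfolds to `limTabOf (j ↦ unitW_j (Wt j 1))`; `hWt1` + `unitW_JsB12Sym_eq_dress` make the family the
dressing of the undressed unit-rescaled tables; the dressing commutes with the constructed limit along `VertexFamily₂` rate data (`limTabOf_dressSym_eq`, the rate TO the
limit from the all-scales rows by `vertexFamily₂_sub_limTabOf`, the limit's class by `vertexFamily₂_limTabOf`); the undressed limit is identified by §2.  Discharges nothing. -/
theorem wPerfOf_JsB12Sym_eq_dress
    (Wt : ℕ → ℕ → Fin (3 + 1) → (Fin (3 + 1) → ℤ) → Fin (3 + 1) → (Fin (3 + 1) → ℤ) → MKer (3 + 1) (Fib 3))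
    (hWt1 : ∀ j, Wt j 1 = (JsB12Sym hLc N tabs cΛ cB j).W)
    {Cw0 cW δW θW : ℝ}
    (hW0 : ∀ j, VertexFamily₂ (unitW (sfStep Lc j) (smStep 3 Lc j) (JsB12Sym0 hLc N tabs cΛ cB j).W) Lc Cw0 δW)
    (hWall0 : ∀ k j, VertexFamily₂ (unitW (sfStep Lc (k + j)) (smStep 3 Lc (k + j)) (JsB12Sym0 hLc N tabs cΛ cB (k + j)).W -
      unitW (sfStep Lc k) (smStep 3 Lc k) (JsB12Sym0 hLc N tabs cΛ cB k).W) Lc (cW * θW ^ k) δW)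
    (hδW : 0 < δW) (hθW0 : 0 ≤ θW) (hθW1 : θW < 1)
    (hK : ∀ j, Decays (unitK (sfStep Lc j) (smStep 3 Lc j) (Gsym (d := 3) Lc j)) C m) (hKinf : Decays Ginf C m)
    (hKrate : ∀ j, Decays (unitK (sfStep Lc j) (smStep 3 Lc j) (Gsym (d := 3) Lc j) - Ginf) (cK * θ ^ j) m)
    (hS : ∀ j, LocStencil (unitS (sfStep Lc j) (smStep 3 Lc j) (SpureSymOf tabs ((Lc : ℝ) ^ 4) (-((Lc : ℝ) ^ 8 / 2)) cΛ j)) Cs m) (hSinf : LocStencil Sinf Cs m)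
    (hSrate : ∀ j, LocStencil (unitS (sfStep Lc j) (smStep 3 Lc j) (SpureSymOf tabs ((Lc : ℝ) ^ 4) (-((Lc : ℝ) ^ 8 / 2)) cΛ j) - Sinf) (cS * θ ^ j) m)
    (hM : ∀ j, VertexFamily (unitM (sfStep Lc j) (smStep 3 Lc j) (tabs.M j)) Lc CM m) (hMinf : VertexFamily Minf Lc CM m)
    (hMrate : ∀ j, VertexFamily (unitM (sfStep Lc j) (smStep 3 Lc j) (tabs.M j) - Minf) Lc (cM * θ ^ j) m)
    (hS₂ : ∀ j, LocStencil₂ (unitS₂ (sfStep Lc j) (smStep 3 Lc j) (T2RecOf 3 Lc (Gsym Lc) (SpureSymOf tabs ((Lc : ℝ) ^ 4) (-((Lc : ℝ) ^ 8 / 2)) cΛ) tabs.M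
      ((Lc : ℝ) ^ 8) cB ((8 * (N : ℝ) ^ 2)⁻¹ • wsym22 N) tabs.vh₂S tabs.mixFF j)) C₂ m) (hS₂inf : LocStencil₂ S₂inf C₂ m)
    (hS₂rate : ∀ j, LocStencil₂ (unitS₂ (sfStep Lc j) (smStep 3 Lc j) (T2RecOf 3 Lc (Gsym Lc) (SpureSymOf tabs ((Lc : ℝ) ^ 4) (-((Lc : ℝ) ^ 8 / 2)) cΛ) tabs.M
      ((Lc : ℝ) ^ 8) cB ((8 * (N : ℝ) ^ 2)⁻¹ • wsym22 N) tabs.vh₂S tabs.mixFF j) - S₂inf) (c₂ * θ ^ j) m)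
    (hM₂ : ∀ j, LocStencilFM Lc (unitM₂ (sfStep Lc j) (smStep 3 Lc j) (M2Of 3 Lc tabs.mixFF j)) CM₂ m) (hM₂inf : LocStencilFM Lc M₂inf CM₂ m)
    (hM₂rate : ∀ j, LocStencilFM Lc (unitM₂ (sfStep Lc j) (smStep 3 Lc j) (M2Of 3 Lc tabs.mixFF j) - M₂inf) (cM₂ * θ ^ j) m)
    (hm : 0 < m) (hθ0 : 0 ≤ θ) (hθ1 : θ < 1) :
    WPerfOf (sfStep Lc) (smStep 3 Lc) Wt 1 = fun μ y ν y' => dressKSymAt (toSite (ctrOff 4 Lc)) Lc (W2SymOfK Ginf Lc Sinf Minf S₂inf M₂inf μ y ν y') := by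
  have hLc1 : 1 ≤ Lc := one_le_of_neZero Lc
  -- the undressed unit-rescaled family, its constructed limit, class and rate
  set W0 : ℕ → Fin 4 → (Fin 4 → ℤ) → Fin 4 → (Fin 4 → ℤ) → MKer 4 (Fib 3) :=
    fun j => unitW (sfStep Lc j) (smStep 3 Lc j) (JsB12Sym0 hLc N tabs cΛ cB j).W with hW0def
  have hlim : limTabOf W0 = W2SymOfK Ginf Lc Sinf Minf S₂inf M₂inf :=
    limTabOf_unitW_JsB12Sym0_eq hLc N tabs cΛ cB hK hKinf hKrate hS hSinf hSrate hM hMinf hMrate hS₂ hS₂inf hS₂rate hM₂ hM₂inf hM₂rate hm hθ0 hθ1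
  have hWi : VertexFamily₂ (limTabOf W0) Lc Cw0 δW := vertexFamily₂_limTabOf hW0 hWall0 hθW1
  have hrate : ∀ j, VertexFamily₂ (W0 j - limTabOf W0) Lc (cW * θW ^ j) δW := fun j => vertexFamily₂_sub_limTabOf hWall0 hθW1 j
  -- the END's family is the dressing of `W0`, member by member
  have e : (fun j => unitW (sfStep Lc j) (smStep 3 Lc j) (Wt j 1)) = fun j μ y ν y' => dressKSymAt (toSite (ctrOff 4 Lc)) Lc (W0 j μ y ν y') := by
    funext j
    rw [hWt1 j]
    exact unitW_JsB12Sym_eq_dress hLc N tabs cΛ cB j (sfStep Lc j) (smStep 3 Lc j)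
  unfold WPerfOf
  rw [e, limTabOf_dressSym_eq hLc1 (ctrOff_mem_box (d := 4) hLc1) hW0 hδW hWi hδW hrate hδW.le hθW0 hθW1, hlim]

/-! ## §4 The table slots discharged by FILE 1 under the new root's pin (M-H) and the block-shape letters (ShH)(Shmix) -/

/-- [our object — bookkeeping] **THE FIXED-POINT EQUATION WITH THE TABLE SLOTS AT THEIR OWN VALUES**: §3 with the (M)(M₂) rows REPLACED by the pin (M-H) `hM1` of the row root
`RowD1JointEndSymWardTables` (an2, p268146), the block-shape letters (ShH)(Shmix) (an1's values are ff-supported; NOT fields of `SymTables`), and ONE letter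
`LocStencilFM Lc tabs.mixFF CM₂ m` at the common rate (`tabs.hH` gives the `H` letter at every rate by itself) — then `M∞ = fun μ w => cΛ • tabs.H μ w` and `M₂∞ = tabs.mixFF`
EXACTLY (`PerfectAveragingTables`, rate zero): the m = 1 tables need no limit.  (G)(S♭)(S₂) stay displayed. -/
theorem wPerfOf_JsB12Sym_eq_dress_of_ff
    (Wt : ℕ → ℕ → Fin (3 + 1) → (Fin (3 + 1) → ℤ) → Fin (3 + 1) → (Fin (3 + 1) → ℤ) → MKer (3 + 1) (Fib 3))
    (hWt1 : ∀ j, Wt j 1 = (JsB12Sym hLc N tabs cΛ cB j).W)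
    {Cw0 cW δW θW : ℝ}
    (hW0 : ∀ j, VertexFamily₂ (unitW (sfStep Lc j) (smStep 3 Lc j) (JsB12Sym0 hLc N tabs cΛ cB j).W) Lc Cw0 δW)
    (hWall0 : ∀ k j, VertexFamily₂ (unitW (sfStep Lc (k + j)) (smStep 3 Lc (k + j)) (JsB12Sym0 hLc N tabs cΛ cB (k + j)).W -
      unitW (sfStep Lc k) (smStep 3 Lc k) (JsB12Sym0 hLc N tabs cΛ cB k).W) Lc (cW * θW ^ k) δW)
    (hδW : 0 < δW) (hθW0 : 0 ≤ θW) (hθW1 : θW < 1)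
    -- (M-H)(ShH)(Shmix) and the mixed table's letter at the common rate
    (hM1 : ∀ (j : ℕ) (ρ : Fin 4) (w : Fin 4 → ℤ), tabs.M j ρ w = M1Of 3 Lc tabs.H cΛ j ρ w)
    (hHff : ∀ μ w, ffK (tabs.H μ w) = tabs.H μ w) (hmixff : ∀ κ u ρ w, ffK (tabs.mixFF κ u ρ w) = tabs.mixFF κ u ρ w)
    (hmixm : LocStencilFM Lc tabs.mixFF CM₂ m)
    -- (G)(S♭)(S₂)
    (hK : ∀ j, Decays (unitK (sfStep Lc j) (smStep 3 Lc j) (Gsym (d := 3) Lc j)) C m) (hKinf : Decays Ginf C m)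
    (hKrate : ∀ j, Decays (unitK (sfStep Lc j) (smStep 3 Lc j) (Gsym (d := 3) Lc j) - Ginf) (cK * θ ^ j) m)
    (hS : ∀ j, LocStencil (unitS (sfStep Lc j) (smStep 3 Lc j) (SpureSymOf tabs ((Lc : ℝ) ^ 4) (-((Lc : ℝ) ^ 8 / 2)) cΛ j)) Cs m) (hSinf : LocStencil Sinf Cs m)
    (hSrate : ∀ j, LocStencil (unitS (sfStep Lc j) (smStep 3 Lc j) (SpureSymOf tabs ((Lc : ℝ) ^ 4) (-((Lc : ℝ) ^ 8 / 2)) cΛ j) - Sinf) (cS * θ ^ j) m)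
    (hS₂ : ∀ j, LocStencil₂ (unitS₂ (sfStep Lc j) (smStep 3 Lc j) (T2RecOf 3 Lc (Gsym Lc) (SpureSymOf tabs ((Lc : ℝ) ^ 4) (-((Lc : ℝ) ^ 8 / 2)) cΛ) tabs.M
      ((Lc : ℝ) ^ 8) cB ((8 * (N : ℝ) ^ 2)⁻¹ • wsym22 N) tabs.vh₂S tabs.mixFF j)) C₂ m) (hS₂inf : LocStencil₂ S₂inf C₂ m)
    (hS₂rate : ∀ j, LocStencil₂ (unitS₂ (sfStep Lc j) (smStep 3 Lc j) (T2RecOf 3 Lc (Gsym Lc) (SpureSymOf tabs ((Lc : ℝ) ^ 4) (-((Lc : ℝ) ^ 8 / 2)) cΛ) tabs.M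
      ((Lc : ℝ) ^ 8) cB ((8 * (N : ℝ) ^ 2)⁻¹ • wsym22 N) tabs.vh₂S tabs.mixFF j) - S₂inf) (c₂ * θ ^ j) m)
    (hm : 0 < m) (hθ0 : 0 ≤ θ) (hθ1 : θ < 1) :
    WPerfOf (sfStep Lc) (smStep 3 Lc) Wt 1 = fun μ y ν y' =>
      dressKSymAt (toSite (ctrOff 4 Lc)) Lc (W2SymOfK Ginf Lc Sinf (fun μ w => cΛ • tabs.H μ w) S₂inf tabs.mixFF μ y ν y') := by
  -- the multiplier tables ARE the `M1Of`-tables (pin (M-H), as functions)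
  have hMfun : ∀ j, tabs.M j = M1Of 3 Lc tabs.H cΛ j := fun j => funext fun ρ => funext fun w => hM1 j ρ w
  -- the `H` letter at the common rate, from the record itself
  obtain ⟨CH, hHm⟩ := tabs.hH m hm.le
  have hM : ∀ j, VertexFamily (unitM (sfStep Lc j) (smStep 3 Lc j) (tabs.M j)) Lc (|cΛ| * CH) m := fun j => by
    rw [hMfun j]; exact vertexFamily_unitM_M1Of_of_ff hHff hHm cΛ j
  have hMrate : ∀ j, VertexFamily (unitM (sfStep Lc j) (smStep 3 Lc j) (tabs.M j) - fun μ w => cΛ • tabs.H μ w) Lc (0 * θ ^ j) m := fun j => by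
    rw [hMfun j]; exact vertexFamily_unitM_M1Of_sub_of_ff hHff cΛ m θ j
  exact wPerfOf_JsB12Sym_eq_dress hLc N tabs cΛ cB Wt hWt1 hW0 hWall0 hδW hθW0 hθW1 hK hKinf hKrate hS hSinf hSrate hM
    (vertexFamily_Minf_of_loc hHm cΛ) hMrate hS₂ hS₂inf hS₂rate (locStencilFM_unitM₂_M2Of_of_ff hmixff hmixm) hmixm
    (locStencilFM_unitM₂_M2Of_sub_of_ff hmixff m θ) hm hθ0 hθ1

end Literal

end Summit.QuantumFields.BalabanUV.Beta.FP.PerfectTableFixedPoint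

end
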